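import Literature.NumberTheory.GaloisRepresentations.AbelianLocalArtinFormalismProofs
import Literature.NumberTheory.GaloisRepresentations.CoinvariantsCharpolyBaseChange
import Literature.NumberTheory.GaloisRepresentations.FrobeniusGeneration
import Literature.NumberTheory.GaloisRepresentations.RestrictFieldSemisimple
import Literature.NumberTheory.GaloisRepresentations.InducedGaloisRep
import Literature.NumberTheory.GaloisRepresentations.FramedRepTwist
import Literature.NumberTheory.EllipticCurves.ArtinFormalismSemistableLocalProofs
import Literature.NumberTheory.EllipticCurves.HasseWeilAbelianEulerFactorForallProofs
import Mathlib.FieldTheory.Galois.Abelian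
import HarnessLib

/-!
# Abelian Artin formalism for `L(E_M, s)`, one prime of `K̄` at a time (Galois side)

Let `E/K` be an elliptic curve over a number field and `M/K` a finite **abelian** extension.
Artin formalism for the abelian extension `M/K` says `L(E_M, s) = ∏_χ L(E ⊗ χ, s)`, the product
over the characters `χ` of `Gal(M/K)`; prime by prime this is the identity of local factors

`∏_{w ∣ v} L_w(E_M, T^{f(w|v)}) = ∏_χ det(1 - Frob_v T | (V_ℓ(E) ⊗ χ)_{I_v})`      (⋆)

for every finite place `v` of `K` — including the places of additive reduction and the places
ramified in `M`, where the right-hand side is the Euler factor of the `ℓ`-adic representation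
`V_ℓ(E) ⊗ χ` defined through inertia coinvariants (Serre, *Facteurs locaux*, §2.3, §4.1).  The main
theorem of this file, `map_prod_expand_localPolynomialAt_baseChange_eq_prod_twist`, proves (⋆) on
the Galois side, for the tree's local Euler factors `WeierstrassCurve.localPolynomialAt` of `E_M`
and for the twists (`FramedRep.twist`) of a framed model of `V_ℓ(E)` with coefficients extended
along any continuous `ℚ_ℓ → 𝔼` (so that `𝔼` may contain the values of the characters), by any
finite family of continuous characters `Γ_K → 𝔼ˣ` trivial on `Γ_M` and satisfying the
orthogonality relations of the character group of `Gal(M/K)`.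

## Proof

Write `D = D_𝔓 ⊇ I = I_𝔓` for a prime `𝔓 ∣ v` of `\bar ℤ_K`, `R = Gal(K̄/M) ⊴ Γ_K` (the image of
`Γ_M`, with abelian quotient `Gal(M/K)`: `commutator_mem_range_absGaloisRestrict`), `D_F = D ∩ R`,
`S = I ∩ R`.
* The abstract part is `prod_reverse_charpoly_toCoinvariants_twist_eq_pow_expand`
  (`AbelianLocalArtinFormalismProofs`, Artin's trace computation on `V_S`):
  `∏_χ det(1 - φT | (V⊗χ)_I) = det(1 - Φ T^f | V_S)^g` for an arithmetic Frobenius `φ ∈ D`, an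
  element `Φ ∈ D_F ∩ φ^f I` (a Frobenius of `M`) with `f` minimal, provided `g · f · [I : S] = #χ`.
* The count: `#χ = [M : K] = [Γ_K : R]` (`index_range_absGaloisRestrict_eq_finrank`);
  `[Γ_K : R] = #{w ∣ v} · [D : D_F]` since the double cosets `D \ Γ_K / R` are the places of `M`
  above `v` (`index_eq_card_mul_index_subgroupOf`, transitivity of `Γ_K`, `Γ_M` on primes); and
  `[D : D_F] = f · [I : S]` since `D = ⟨φ⟩ · I · D_F`
  (`exists_eq_frobenius_pow_mul_of_mem_decompositionSubgroup`) with `φ` of order exactly `f`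
  modulo `I D_F` (`index_eq_mul_index_subgroupOf_of_generator`); hence `g = #{w ∣ v}`.
* The dictionary: `det(1 - ΦT | V_S) = L_{w₀}(E_M, T)` for the place `w₀` of `M` below `𝔓`
  (`map_localPolynomialAt_baseChange_eq_reverse_charpoly`: the inertia group of `M` above `w₀`
  maps onto `S`, `V_ℓ(E_M) ≅ V_ℓ(E)|_{Γ_M}`, and the tree's
  `reverse_charpoly_toInertiaCoinvariants_eq_localPolynomialAt`), after extending scalars
  `ℚ_ℓ → 𝔼` (`charpoly_toCoinvariants_map`, `CoinvariantsCharpolyBaseChange`).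
* All `L_w(E_M, T)`, `w ∣ v`, coincide (`localPolynomialAt_baseChange_eq_of_isGalois`:
  conjugation by `τ ∈ Γ_K` with `τ𝔓₁ = 𝔓₂`, `charpoly_toCoinvariants_conj`), and all `f(w|v)`
  coincide (Mathlib `Ideal.inertiaDeg_eq_of_isGaloisGroup`).

This file is theorem-only (no new definitions or named facts); it is the local input, valid at
every prime, for the reduction of `hasEntireLFunction_baseChange_fixedField`
(`AnalyticRankOverNumberField`) to the modularity of `E/ℚ` and the Galois representations of
twisted newforms.

## References

* J. Neukirch, *Algebraic Number Theory*, Springer GMW 322 (1999), VII (10.4) (iv) and its proof,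
  pp. 523–524 (Artin formalism: induction, local factors place by place). [NeukirchANT1999]
* J.-P. Serre, *Facteurs locaux des fonctions zêta des variétés algébriques*, Sém. DPP 1969/70,
  exp. 19, §2.3, §4.1 (local factors via inertia (co)invariants; additivity, inductivity).
* K. Ireland, M. Rosen, *A Classical Introduction to Modern Number Theory*, 2nd ed., GTM 84,
  Ch. 20 §5, Prop. 20.5.4 (b) (the quadratic case of `L(E_M,s) = ∏ L(E⊗χ,s)`). [IrelandRosen1990]
* J. H. Silverman, *The Arithmetic of Elliptic Curves*, 2nd ed., GTM 106, V.2.3.1 and §C.16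
  (local factors of `E` over number fields). [SilvermanAEC2009]

## Mathlib / tree search

Tree: `prod_reverse_charpoly_toCoinvariants_twist_eq_pow_expand` (`AbelianLocalArtinFormalismProofs`),
`charpoly_toCoinvariants_map` (`CoinvariantsCharpolyBaseChange`),
`localPolynomialAt_baseChange_of_forall_inertia` (`ArtinFormalismSemistableLocalProofs`, the
semistable/unramified special case of (⋆) with explicit factors),
`ArtinRep.eulerFactorAt_eq_prod_expand_of_isInducedFrom` (`ArtinFormalismInductionProofs`, the
Artin-representation analogue; its double-coset bookkeeping is reused here),
`exists_eq_frobenius_pow_mul_of_mem_decompositionSubgroup` (`FrobeniusGeneration`),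
`normal_range_absGaloisRestrict`, `isOpen_range_absGaloisRestrict`,
`reverse_charpoly_toInertiaCoinvariants_eq_localPolynomialAt`.  Mathlib: `IsAbelianGalois`,
`Ideal.inertiaDeg_eq_of_isGaloisGroup`, `Subgroup.relIndex_*`.
`lean search 'localPolynomialAt_baseChange_eq_of_isGalois|prod_twist|AbelianGaloisLocal'`: no prior hits.
-/

noncomputable section

open scoped NumberField Polynomial Pointwise Matrix
open NumberField IsDedekindDomain IsDedekindDomain.HeightOneSpectrum Field Polynomial
  Literature.NumberTheory.GaloisRepresentations Literature.NumberTheory.EllipticCurves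
  Literature.RepresentationTheory.Semisimple

universe u

namespace Literature.NumberTheory.EllipticCurves

/-! ### Two counting lemmas in abstract groups -/

section Group

variable {G : Type*} [Group G]

/-- **`[D : D_F] = f · [I : I ∩ D_F]` from a Frobenius generator.**  Let `I, D_F ⊴ D`, `φ ∈ D`
and `f ≥ 1` be such that `D = ⟨φ⟩ · I · D_F`, `φ^f ∈ I · D_F`, and `f ∣ m` whenever
`φ^m i ∈ D_F` for some `i ∈ I` (`m ≥ 1`).  Then `D ⧸ (I D_F)` is cyclic of order `f` generated by
`φ`, so `[D : D_F] = f · [I D_F : D_F] = f · [I : I ∩ D_F]`.  (With `D = D_𝔓 ⊇ I = I_𝔓` the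
decomposition and inertia groups of a prime of `K̄` and `D_F = D ∩ Gal(K̄/M)`: the local degree
is `e · f`.) [folklore] -/
theorem index_eq_mul_index_subgroupOf_of_generator (I DF : Subgroup G) [I.Normal] [DF.Normal]
    {φ : G} {f : ℕ} (hf : 0 < f)
    (hgen : ∀ d : G, ∃ (a : ℕ) (i : G), i ∈ I ∧ (φ ^ a * i)⁻¹ * d ∈ DF)
    (hpow : ∃ i ∈ I, ∃ u ∈ DF, φ ^ f = i * u)
    (hmin : ∀ m : ℕ, 0 < m → (∃ i ∈ I, φ ^ m * i ∈ DF) → f ∣ m) :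
    DF.index = f * (DF.subgroupOf I).index := by
  set B : Subgroup G := I ⊔ DF with hB
  have hBmem : ∀ y, y ∈ B ↔ ∃ i ∈ I, ∃ u ∈ DF, i * u = y := by
    intro y
    rw [← SetLike.mem_coe, hB, Subgroup.normal_mul, Set.mem_mul]
    simp only [SetLike.mem_coe]
  have hφf : φ ^ f ∈ B := by
    obtain ⟨i, hi, u, hu, h⟩ := hpow
    exact (hBmem _).2 ⟨i, hi, u, hu, h.symm⟩
  have hφfm : ∀ m : ℕ, φ ^ (f * m) ∈ B := fun m => by
    rw [pow_mul]; exact B.pow_mem hφf m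
  -- `φ^m ∈ B` with `m < f` forces `m = 0`
  have hsmall : ∀ m : ℕ, m < f → φ ^ m ∈ B → m = 0 := by
    intro m hm hmem
    by_contra hm0
    obtain ⟨i, hi, u, hu, hiu⟩ := (hBmem _).1 hmem
    have hdvd : f ∣ m := by
      refine hmin m (Nat.pos_of_ne_zero hm0) ⟨(φ ^ m)⁻¹ * i⁻¹ * φ ^ m, ?_, ?_⟩
      · have := ‹I.Normal›.conj_mem _ (I.inv_mem hi) (φ ^ m)⁻¹
        rwa [inv_inv] at this
      · rw [show φ ^ m * ((φ ^ m)⁻¹ * i⁻¹ * φ ^ m) = i⁻¹ * (i * u) by rw [hiu]; group,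
          inv_mul_cancel_left]
        exact hu
    exact absurd (Nat.le_of_dvd (Nat.pos_of_ne_zero hm0) hdvd) (not_le.mpr hm)
  -- `D ⧸ B` has exactly `f` elements `φ^a B`, `a < f`
  have hcardB : B.index = f := by
    rw [Subgroup.index]
    set F : Fin f → G ⧸ B := fun a => ((φ ^ (a : ℕ) : G) : G ⧸ B) with hF
    have hbij : Function.Bijective F := by
      constructor
      · intro a b hab
        rw [hF] at hab
        simp only at hab
        rw [QuotientGroup.eq] at hab
        apply Fin.ext
        rcases le_total (a : ℕ) b with hle | hle
        · have hmem : φ ^ ((b : ℕ) - a) ∈ B := by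
            have : (φ ^ (a : ℕ))⁻¹ * φ ^ (b : ℕ) = φ ^ ((b : ℕ) - a) := by
              rw [inv_mul_eq_iff_eq_mul, ← pow_add, Nat.add_sub_cancel' hle]
            rwa [this] at hab
          have := hsmall _ (lt_of_le_of_lt (Nat.sub_le _ _) b.2) hmem
          omega
        · have hmem : φ ^ ((a : ℕ) - b) ∈ B := by
            have : ((φ ^ (a : ℕ))⁻¹ * φ ^ (b : ℕ))⁻¹ = φ ^ ((a : ℕ) - b) := by
              rw [mul_inv_rev, inv_inv, inv_mul_eq_iff_eq_mul, ← pow_add, Nat.add_sub_cancel' hle]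
            rw [← this]
            exact B.inv_mem hab
          have := hsmall _ (lt_of_le_of_lt (Nat.sub_le _ _) a.2) hmem
          omega
      · intro q
        induction q using QuotientGroup.induction_on with
        | H d =>
          obtain ⟨a, i, hi, hd⟩ := hgen d
          refine ⟨⟨a % f, Nat.mod_lt a hf⟩, ?_⟩
          rw [hF]
          simp only
          rw [QuotientGroup.eq]
          have h1 : (φ ^ (a % f))⁻¹ * d = φ ^ (f * (a / f)) * (i * ((φ ^ a * i)⁻¹ * d)) := by
            rw [show φ ^ a = φ ^ (a % f) * φ ^ (f * (a / f)) by
              rw [← pow_add, Nat.mod_add_div]]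
            group
          rw [h1]
          exact B.mul_mem (hφfm _) (B.mul_mem (Subgroup.mem_sup_left hi)
            (Subgroup.mem_sup_right hd))
    rw [← Nat.card_eq_of_bijective F hbij, Nat.card_eq_fintype_card, Fintype.card_fin]
  calc DF.index = DF.relIndex B * B.index := (Subgroup.relIndex_mul_index le_sup_right).symm
    _ = (DF.subgroupOf I).index * f := by rw [hB, Subgroup.relIndex_sup_right, hcardB]; rfl
    _ = f * (DF.subgroupOf I).index := mul_comm _ _

/-- **`[G : R] = #ι · [D : D ∩ R]` from a double coset decomposition `G = ⊔ᵢ D τᵢ R` with `R`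
normal.**  (With `G = Γ_K`, `R = Gal(K̄/M)` for `M/K` Galois, `D = D_𝔓`: the double cosets
`D_𝔓 \ Γ_K / Γ_M` are the places `w ∣ v` of `M`, and `[Γ_K : Γ_M] = [M : K] = g · e · f`.)
[folklore] -/
theorem index_eq_card_mul_index_subgroupOf (R D : Subgroup G) [R.Normal] {ι : Type*}
    (τ : ι → G) (h1 : ∀ x : G, ∃ i, ∃ d ∈ D, ∃ r ∈ R, x = d * τ i * r)
    (h2 : ∀ i j, (∃ d ∈ D, ∃ r ∈ R, τ j = d * τ i * r) → i = j) :
    R.index = Nat.card ι * (R.subgroupOf D).index := by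
  rw [Subgroup.index, Subgroup.index, ← Nat.card_prod]
  symm
  -- the map `(i, d (D ∩ R)) ↦ d τᵢ R`
  have hwd : ∀ (i : ι) (a b : D), (a : G)⁻¹ * b ∈ R →
      (((a : G) * τ i : G) : G ⧸ R) = (((b : G) * τ i : G) : G ⧸ R) := by
    intro i a b hab
    rw [QuotientGroup.eq]
    have : ((a : G) * τ i)⁻¹ * ((b : G) * τ i) = (τ i)⁻¹ * ((a : G)⁻¹ * b) * (τ i)⁻¹⁻¹ := by
      group
    rw [this]
    exact ‹R.Normal›.conj_mem _ hab _
  let F : ι × (D ⧸ R.subgroupOf D) → G ⧸ R := fun p =>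
    Quotient.lift (fun d : D => (((d : G) * τ p.1 : G) : G ⧸ R))
      (fun a b hab => hwd p.1 a b (by
        have := QuotientGroup.leftRel_apply.mp hab
        exact this)) p.2
  have hF : ∀ (i : ι) (d : D), F (i, (d : D ⧸ R.subgroupOf D)) = (((d : G) * τ i : G) : G ⧸ R) :=
    fun _ _ => rfl
  refine Nat.card_eq_of_bijective F ⟨?_, ?_⟩
  · rintro ⟨i, qa⟩ ⟨j, qb⟩ hab
    induction qa using QuotientGroup.induction_on with
    | H a =>
      induction qb using QuotientGroup.induction_on with
      | H b =>
        rw [hF, hF, QuotientGroup.eq] at hab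
        -- `τ j = (b⁻¹ a) τ i r` with `r = (a τ i)⁻¹ (b τ j) ∈ R`
        obtain rfl : i = j := h2 i j ⟨(b : G)⁻¹ * a, D.mul_mem (D.inv_mem b.2) a.2,
          ((a : G) * τ i)⁻¹ * ((b : G) * τ j), hab, by group⟩
        have hmem : (a : G)⁻¹ * b ∈ R := by
          have : (a : G)⁻¹ * b = τ i * (((a : G) * τ i)⁻¹ * ((b : G) * τ i)) * (τ i)⁻¹ := by
            group
          rw [this]
          exact ‹R.Normal›.conj_mem _ hab _
        have : (a : D ⧸ R.subgroupOf D) = b := by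
          rw [QuotientGroup.eq, Subgroup.mem_subgroupOf]
          exact hmem
        rw [this]
  · intro q
    induction q using QuotientGroup.induction_on with
    | H x =>
      obtain ⟨i, d, hd, r, hr, rfl⟩ := h1 x
      refine ⟨(i, ((⟨d, hd⟩ : D) : D ⧸ R.subgroupOf D)), ?_⟩
      rw [hF, QuotientGroup.eq]
      rw [show (d * τ i)⁻¹ * (d * τ i * r) = r by group]
      exact hr

end Group

/-! ### The Galois group of an abelian extension inside `Γ_K` -/

section Galois

variable (K M : Type*) [Field K] [Field M] [Algebra K M] [FiniteDimensional K M]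

/-- For `M/K` finite abelian, commutators of `Γ_K` lie in `Gal(K̄/M) = res(Γ_M)`:
`Γ_K / res(Γ_M) ≅ Gal(M/K)` is abelian (restriction to the copy `e(M) ⊆ K̄`, Mathlib
`AlgEquiv.restrictNormalHom`). [folklore] -/
theorem commutator_mem_range_absGaloisRestrict [IsAbelianGalois K M]
    (g h : absoluteGaloisGroup K) :
    g * h * g⁻¹ * h⁻¹ ∈ (absGaloisRestrict K M).range := by
  haveI : Algebra.IsAlgebraic K M := Algebra.IsAlgebraic.of_finite K M
  obtain ⟨e, hrange⟩ := exists_mem_range_absGaloisRestrict_iff K M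
  letI : Algebra M (AlgebraicClosure K) := e.toRingHom.toAlgebra
  haveI : IsScalarTower K M (AlgebraicClosure K) :=
    IsScalarTower.of_algebraMap_eq fun x ↦ (e.commutes x).symm
  set r : absoluteGaloisGroup K →* (M ≃ₐ[K] M) :=
    (AlgEquiv.restrictNormalHom M).comp (absoluteGaloisGroup.toAlgEquiv K).toMonoidHom with hr
  have hre : ∀ (γ : absoluteGaloisGroup K) (x : M), γ • e x = e (r γ x) := fun γ x => by
    rw [absoluteGaloisGroup.smul_def]
    exact (AlgEquiv.restrictNormal_commutes (absoluteGaloisGroup.toAlgEquiv K γ) M x).symm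
  rw [hrange]
  intro x
  rw [hre, map_mul, map_mul, map_mul, map_inv, map_inv, mul_comm' (r g) (r h), mul_inv_cancel_right,
    mul_inv_cancel, AlgEquiv.one_apply]

end Galois

/-! ### Conjugation invariance of coinvariant characteristic polynomials -/

section Conj

variable {k : Type*} [Field k] {G : Type*} [Group G] {V : Type*} [AddCommGroup V] [Module k V]
  [FiniteDimensional k V]

/-- **Coinvariant characteristic polynomials are conjugation invariant.**  Let `ρ : G → GL(V)`,
`τ ∈ G`, `D₁, D₂ ≤ G` with `τ D₁ τ⁻¹ ≤ D₂`, and normal subgroups `S₁ ⊴ D₁`, `S₂ ⊴ D₂` with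
`S₂ = τ S₁ τ⁻¹`.  Then for `x ∈ D₁` the action of `x` on `V_{S₁}` and that of `τ x τ⁻¹` on
`V_{S₂}` have the same characteristic polynomial (`ρ(τ) : V_{S₁} ≃ V_{S₂}`). [folklore] -/
theorem charpoly_toCoinvariants_conj (ρ : Representation k G V) (τ : G) (D₁ D₂ : Subgroup G)
    (hD : ∀ d ∈ D₁, τ * d * τ⁻¹ ∈ D₂) (S₁ : Subgroup D₁) [S₁.Normal] (S₂ : Subgroup D₂)
    [S₂.Normal] (hS : ∀ y : D₂, y ∈ S₂ ↔ ∃ x : D₁, x ∈ S₁ ∧ τ * (x : G) * τ⁻¹ = y) (x : D₁) :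
    (Representation.toCoinvariants (ρ.comp D₁.subtype) S₁ x).charpoly =
      (Representation.toCoinvariants (ρ.comp D₂.subtype) S₂ ⟨τ * x * τ⁻¹, hD x x.2⟩).charpoly := by
  set c : D₁ →* D₂ :=
    { toFun := fun d => ⟨τ * d * τ⁻¹, hD d d.2⟩
      map_one' := Subtype.ext (by simp)
      map_mul' := fun a b => Subtype.ext (by
        simp only [Subgroup.coe_mul]
        group) } with hc
  have hcval : ∀ d : D₁, ((c d : D₂) : G) = τ * d * τ⁻¹ := fun _ => rfl
  set E : V ≃ₗ[k] V := LinearEquiv.ofLinear (ρ τ) (ρ τ⁻¹)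
    (by rw [← Module.End.mul_eq_comp, ← map_mul, mul_inv_cancel, map_one]; rfl)
    (by rw [← Module.End.mul_eq_comp, ← map_mul, inv_mul_cancel, map_one]; rfl) with hE
  have hEa : ∀ v, E v = ρ τ v := fun _ => rfl
  have hEq : ∀ (d : D₁) (v : V), E ((ρ.comp D₁.subtype) d v) = (ρ.comp D₂.subtype) (c d) (E v) := by
    intro d v
    rw [hEa, hEa, comp_subtype_apply, comp_subtype_apply, hcval, map_mul, map_mul,
      Module.End.mul_apply, Module.End.mul_apply, ← Module.End.mul_apply (ρ τ⁻¹), ← map_mul,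
      inv_mul_cancel, map_one, Module.End.one_apply]
  have hSmap : S₁.map c = S₂ := by
    ext y
    rw [Subgroup.mem_map, hS]
    constructor
    · rintro ⟨x, hx, rfl⟩
      exact ⟨x, hx, rfl⟩
    · rintro ⟨x, hx, hxy⟩
      exact ⟨x, hx, Subtype.ext hxy⟩
  have hmap := map_ker_comp_subtype_eq_of_equiv (ρ.comp D₂.subtype) (ρ.comp D₁.subtype) c E hEq S₁
  rw [hSmap] at hmap
  convert charpoly_toCoinvariants_eq_of_map_ker_eq (ρ.comp D₂.subtype) (ρ.comp D₁.subtype) c E hEq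
    S₂ S₁ hmap x using 1
  rfl

end Conj

/-! ### `L_w(E_M, T)` as a coinvariant characteristic polynomial on `V_ℓ(E)` -/

section Dictionary

variable {K : Type u} [Field K] [NumberField K] (W : WeierstrassCurve K) [W.IsElliptic]
  (M : Type u) [Field M] [NumberField M] [Algebra K M] [FiniteDimensional K M]

omit [NumberField K] in
set_option maxHeartbeats 1600000 in
/-- **`L_w(E_M, T) = det(1 - res Φ_w · T | (V_ℓ E)_{I_𝔓 ∩ Γ_M})`.**  Let `E/K` be an elliptic
curve, `M/K` finite, `w ∣ v` finite places, `ℓ ∤ v`, `𝔔 ∣ w` a prime of `\bar ℤ_M` with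
Frobenius `Φ ∈ Γ_M`, and `𝔓 = ι⁻¹ 𝔔 ∣ v` its contraction to `\bar ℤ_K`.  The inertia group
`I_𝔔 ≤ Γ_M` maps onto `S = I_𝔓 ∩ res(Γ_M) ≤ D_𝔓`, and `V_ℓ(E_M) ≅ V_ℓ(E)` `Γ_M`-equivariantly
(`exists_rationalTateModule_equiv_baseChange`), so the Euler factor of `E_M` at `w`
(`reverse_charpoly_toInertiaCoinvariants_eq_localPolynomialAt`) is the reverse characteristic
polynomial of `res Φ` on the `S`-coinvariants of `V_ℓ(E)|_{D_𝔓}`.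
[cite: SilvermanAEC2009, V.2.3.1 and §C.16 (PDF p. 390)] -/
theorem map_localPolynomialAt_baseChange_eq_reverse_charpoly (ℓ : ℕ) [Fact ℓ.Prime]
    {v : HeightOneSpectrum (𝓞 K)} (hℓv : (ℓ : 𝓞 K) ∉ v.asIdeal)
    {w : HeightOneSpectrum (𝓞 M)} (hw : w.asIdeal.under (𝓞 K) = v.asIdeal)
    {𝔔 : Ideal (absIntegers (𝓞 M) M)} (h𝔔 : 𝔔 ∈ w.primesAbove)
    {Φ : absoluteGaloisGroup M} (hΦ : IsArithFrobAt (𝓞 M) Φ 𝔔)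
    {𝔓 : Ideal (absIntegers (𝓞 K) K)} (h𝔓𝔔 : 𝔔.comap (absIntegersMap K M) = 𝔓)
    (S : Subgroup (𝔓.decompositionSubgroup (absoluteGaloisGroup K))) [S.Normal]
    (hS : ∀ x, x ∈ S ↔
      (x : absoluteGaloisGroup K) ∈ 𝔓.inertia (absoluteGaloisGroup K) ∧
        (x : absoluteGaloisGroup K) ∈ (absGaloisRestrict K M).range)
    (Φ' : 𝔓.decompositionSubgroup (absoluteGaloisGroup K))
    (hΦ' : (Φ' : absoluteGaloisGroup K) = absGaloisRestrict K M Φ) :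
    haveI := W.module_finite_rationalTateModule_holds ℓ
    ((W.baseChange M).localPolynomialAt w).map (Int.castRingHom ℚ_[ℓ]) =
      (Representation.toCoinvariants ((rationalTateGaloisRepOf (WeierstrassCurve.geomPoints W) ℓ
          (W.continuous_rationalGaloisRepTate_holds ℓ)).toRepresentation.comp
          (𝔓.decompositionSubgroup (absoluteGaloisGroup K)).subtype) S Φ').charpoly.reverse := by
  haveI : Algebra.IsAlgebraic K M := Algebra.IsAlgebraic.of_finite K M
  haveI hEK : (W.baseChange M).IsElliptic := by rw [WeierstrassCurve.baseChange]; infer_instance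
  have hℓw : (ℓ : 𝓞 M) ∉ w.asIdeal := by
    intro hmem
    apply hℓv
    have : (ℓ : 𝓞 M) = algebraMap (𝓞 K) (𝓞 M) ℓ := by simp
    rw [this] at hmem
    rw [← hw, Ideal.under_def, Ideal.mem_comap]
    exact hmem
  haveI := W.module_finite_rationalTateModule_holds ℓ
  haveI := (W.baseChange M).module_finite_rationalTateModule_holds ℓ
  have hcW := W.continuous_rationalGaloisRepTate_holds ℓ
  have hcK := (W.baseChange M).continuous_rationalGaloisRepTate_holds ℓ
  set ρ := rationalTateGaloisRepOf (WeierstrassCurve.geomPoints W) ℓ hcW with hρ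
  set ρK := rationalTateGaloisRepOf (WeierstrassCurve.geomPoints (W.baseChange M)) ℓ hcK with hρK
  obtain ⟨EK, hEK⟩ := W.exists_rationalTateModule_equiv_baseChange M ℓ
  haveI : 𝔔.IsPrime := h𝔔.1
  have h𝔓 : 𝔓 ∈ v.primesAbove := h𝔓𝔔 ▸ comap_absIntegersMap_mem_primesAbove hw h𝔔
  haveI : 𝔓.IsPrime := h𝔓.1
  set DQ := 𝔔.decompositionSubgroup (absoluteGaloisGroup M) with hDQ
  have hΦD : Φ ∈ DQ := hΦ.mem_stabilizer
  have hresD : ∀ γ : absoluteGaloisGroup M, γ ∈ DQ →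
      absGaloisRestrict K M γ ∈ 𝔓.decompositionSubgroup (absoluteGaloisGroup K) := by
    intro γ hγ
    have h : γ ∈ (𝔓.decompositionSubgroup (absoluteGaloisGroup K)).comap
        (absGaloisRestrict K M).toMonoidHom := by
      rw [← h𝔓𝔔, comap_decompositionSubgroup_comap_absIntegersMap K M 𝔔]
      exact hγ
    exact h
  set f : DQ →* 𝔓.decompositionSubgroup (absoluteGaloisGroup K) :=
    ((absGaloisRestrict K M).toMonoidHom.comp DQ.subtype).codRestrict _ (fun γ ↦ hresD γ γ.2)
    with hfdef
  have hfval : ∀ γ : DQ, ((f γ : 𝔓.decompositionSubgroup (absoluteGaloisGroup K)) :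
      absoluteGaloisGroup K) = absGaloisRestrict K M γ := fun _ ↦ rfl
  set ρD : Representation ℚ_[ℓ] (𝔓.decompositionSubgroup (absoluteGaloisGroup K))
      (W.rationalTateModule ℓ) :=
    ρ.toRepresentation.comp (𝔓.decompositionSubgroup (absoluteGaloisGroup K)).subtype with hρD
  have hmemIQ : ∀ y : DQ, y ∈ 𝔔.inertia DQ ↔
      (y : absoluteGaloisGroup M) ∈ 𝔔.inertia (absoluteGaloisGroup M) :=
    fun y ↦ Iff.rfl
  -- `f(I_𝔔) = S`
  have hSeq : (𝔔.inertia DQ).map f = S := by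
    ext x
    rw [hS, Subgroup.mem_map]
    constructor
    · rintro ⟨γ, hγ, rfl⟩
      rw [hfval]
      refine ⟨?_, ⟨γ, rfl⟩⟩
      rw [← h𝔓𝔔]
      exact absGaloisRestrict_mem_inertia_comap K M ((hmemIQ γ).mp hγ)
    · rintro ⟨hxI, ⟨γ₀, hγ₀⟩⟩
      have hγ₀I : γ₀ ∈ 𝔔.inertia (absoluteGaloisGroup M) := by
        rw [← comap_inertia_comap_absIntegersMap K M 𝔔, Subgroup.mem_comap, hγ₀, h𝔓𝔔]
        exact hxI
      refine ⟨⟨γ₀, Ideal.inertia_le_decompositionSubgroup _ _ hγ₀I⟩, (hmemIQ _).mpr hγ₀I, ?_⟩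
      apply Subtype.ext
      rw [hfval]
      exact hγ₀
  have hΦ'' : Φ' = f ⟨Φ, hΦD⟩ := Subtype.ext (by rw [hfval, hΦ'])
  subst hΦ''
  -- `L_w(W_M)` at `Φ`, transported to `ρD`
  have hQ : (Representation.toCoinvariants (ρK.toRepresentation.comp DQ.subtype) (𝔔.inertia DQ)
      ⟨Φ, hΦD⟩).charpoly.reverse =
      ((W.baseChange M).localPolynomialAt w).map (Int.castRingHom ℚ_[ℓ]) :=
    (W.baseChange M).reverse_charpoly_toInertiaCoinvariants_eq_localPolynomialAt ℓ hcK hℓw h𝔔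
      ⟨Φ, hΦD⟩ hΦ
  rw [← hQ]
  congr 1
  refine charpoly_toCoinvariants_eq_of_map_ker_eq ρD (ρK.toRepresentation.comp DQ.subtype) f
    EK.symm (fun g x ↦ ?_) S (𝔔.inertia DQ)
    ((map_ker_comp_subtype_eq_of_equiv ρD (ρK.toRepresentation.comp DQ.subtype) f EK.symm
      (fun g x ↦ ?_) (𝔔.inertia DQ)).trans (by rw [hSeq])) ⟨Φ, hΦD⟩
  all_goals
    apply EK.injective
    rw [LinearEquiv.apply_symm_apply]
    change (W.baseChange M).rationalGaloisRepTate ℓ (g : absoluteGaloisGroup M) x =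
      EK (W.rationalGaloisRepTate ℓ (absGaloisRestrict K M g) (EK.symm x))
    rw [hEK, LinearEquiv.apply_symm_apply]

set_option maxHeartbeats 1600000 in
set_option synthInstance.maxHeartbeats 80000 in
/-- **Galois invariance of the Euler factors of `E_M`.**  For `E/K` an elliptic curve and `M/K`
a finite Galois extension, the Euler factors `L_w(E_M, T)` at all places `w` of `M` above a
fixed place `v` of `K` coincide (the places above `v` are permuted transitively by `Gal(M/K)`
and `E` is defined over `K`).  Proof on the Galois side: by
`map_localPolynomialAt_baseChange_eq_reverse_charpoly` both are coinvariant characteristic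
polynomials on `V_ℓ(E)` at primes `𝔓₁, 𝔓₂ ∣ v` of `\bar ℤ_K`, which are `Γ_K`-conjugate
(`exists_smul_eq_of_mem_primesAbove`); conjugation by `τ ∈ Γ_K` with `τ𝔓₁ = 𝔓₂` matches the
subgroups `I_{𝔓ᵢ} ∩ Γ_M` (`Γ_M ⊴ Γ_K`) and carries a Frobenius of `M` at `𝔓₁` to one at `𝔓₂`
up to `I_{𝔓₂} ∩ Γ_M` (equal residue degrees, Mathlib `Ideal.inertiaDeg_eq_of_isGaloisGroup`).
[cite: SilvermanAEC2009, V.2.3.1 and §C.16 (PDF p. 390)] -/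
theorem localPolynomialAt_baseChange_eq_of_isGalois [IsGalois K M]
    {v : HeightOneSpectrum (𝓞 K)} {w₁ w₂ : HeightOneSpectrum (𝓞 M)}
    (hw₁ : w₁.asIdeal.under (𝓞 K) = v.asIdeal) (hw₂ : w₂.asIdeal.under (𝓞 K) = v.asIdeal) :
    (W.baseChange M).localPolynomialAt w₁ = (W.baseChange M).localPolynomialAt w₂ := by
  classical
  haveI : Algebra.IsAlgebraic K M := Algebra.IsAlgebraic.of_finite K M
  obtain ⟨ℓ, hℓp, hℓv⟩ := HeightOneSpectrum.exists_prime_natCast_not_mem v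
  haveI : Fact ℓ.Prime := ⟨hℓp⟩
  haveI := W.module_finite_rationalTateModule_holds ℓ
  have hcW := W.continuous_rationalGaloisRepTate_holds ℓ
  set ρ := rationalTateGaloisRepOf (WeierstrassCurve.geomPoints W) ℓ hcW with hρ
  set R : Subgroup (absoluteGaloisGroup K) := (absGaloisRestrict K M).range with hR
  haveI hRN : R.Normal := normal_range_absGaloisRestrict K M
  set ι := absIntegersMap K M with hι
  -- residue degrees agree
  have hf : w₁.asIdeal.inertiaDeg (𝓞 K) = w₂.asIdeal.inertiaDeg (𝓞 K) := by
    haveI : IsGaloisGroup (M ≃ₐ[K] M) (𝓞 K) (𝓞 M) := IsGaloisGroup.of_isFractionRing _ _ _ K M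
    haveI := w₁.isPrime
    haveI := w₂.isPrime
    haveI : w₁.asIdeal.LiesOver v.asIdeal := ⟨hw₁.symm⟩
    haveI : w₂.asIdeal.LiesOver v.asIdeal := ⟨hw₂.symm⟩
    exact Ideal.inertiaDeg_eq_of_isGaloisGroup v.asIdeal w₁.asIdeal w₂.asIdeal (M ≃ₐ[K] M)
  -- primes and Frobenii above `w₁`, `w₂`
  obtain ⟨𝔔₁, h𝔔₁⟩ := HeightOneSpectrum.primesAbove_nonempty w₁
  obtain ⟨𝔔₂, h𝔔₂⟩ := HeightOneSpectrum.primesAbove_nonempty w₂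
  haveI : 𝔔₁.IsPrime := h𝔔₁.1
  haveI : 𝔔₂.IsPrime := h𝔔₂.1
  obtain ⟨Φ₁, hΦ₁⟩ := HeightOneSpectrum.exists_isArithFrobAt_of_mem_primesAbove_holds h𝔔₁
  obtain ⟨Φ₂, hΦ₂⟩ := HeightOneSpectrum.exists_isArithFrobAt_of_mem_primesAbove_holds h𝔔₂
  set 𝔓₁ := 𝔔₁.comap ι with h𝔓₁def
  set 𝔓₂ := 𝔔₂.comap ι with h𝔓₂def
  have h𝔓₁ : 𝔓₁ ∈ v.primesAbove := comap_absIntegersMap_mem_primesAbove hw₁ h𝔔₁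
  have h𝔓₂ : 𝔓₂ ∈ v.primesAbove := comap_absIntegersMap_mem_primesAbove hw₂ h𝔔₂
  haveI : 𝔓₁.IsPrime := h𝔓₁.1
  haveI : 𝔓₂.IsPrime := h𝔓₂.1
  set DP₁ := 𝔓₁.decompositionSubgroup (absoluteGaloisGroup K) with hDP₁
  set DP₂ := 𝔓₂.decompositionSubgroup (absoluteGaloisGroup K) with hDP₂
  have hresD₁ : absGaloisRestrict K M Φ₁ ∈ DP₁ := by
    have h : Φ₁ ∈ DP₁.comap (absGaloisRestrict K M).toMonoidHom := by
      rw [hDP₁, h𝔓₁def, hι, comap_decompositionSubgroup_comap_absIntegersMap K M 𝔔₁]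
      exact hΦ₁.mem_stabilizer
    exact h
  have hresD₂ : absGaloisRestrict K M Φ₂ ∈ DP₂ := by
    have h : Φ₂ ∈ DP₂.comap (absGaloisRestrict K M).toMonoidHom := by
      rw [hDP₂, h𝔓₂def, hι, comap_decompositionSubgroup_comap_absIntegersMap K M 𝔔₂]
      exact hΦ₂.mem_stabilizer
    exact h
  -- the subgroups `Sᵢ = (I_{𝔓ᵢ} ∩ R) ≤ D_{𝔓ᵢ}`
  set S₁ : Subgroup DP₁ := 𝔓₁.inertia DP₁ ⊓ R.subgroupOf DP₁ with hS₁
  set S₂ : Subgroup DP₂ := 𝔓₂.inertia DP₂ ⊓ R.subgroupOf DP₂ with hS₂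
  have hS₁mem : ∀ x, x ∈ S₁ ↔ (x : absoluteGaloisGroup K) ∈ 𝔓₁.inertia (absoluteGaloisGroup K) ∧
      (x : absoluteGaloisGroup K) ∈ R := fun x ↦ by
    rw [hS₁, Subgroup.mem_inf, Subgroup.mem_subgroupOf]; rfl
  have hS₂mem : ∀ x, x ∈ S₂ ↔ (x : absoluteGaloisGroup K) ∈ 𝔓₂.inertia (absoluteGaloisGroup K) ∧
      (x : absoluteGaloisGroup K) ∈ R := fun x ↦ by
    rw [hS₂, Subgroup.mem_inf, Subgroup.mem_subgroupOf]; rfl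
  have hinj : Function.Injective (Polynomial.map (Int.castRingHom ℚ_[ℓ])) :=
    Polynomial.map_injective _ (RingHom.injective_int _)
  apply hinj
  rw [map_localPolynomialAt_baseChange_eq_reverse_charpoly W M ℓ hℓv hw₁ h𝔔₁ hΦ₁ rfl S₁ hS₁mem
      ⟨_, hresD₁⟩ rfl,
    map_localPolynomialAt_baseChange_eq_reverse_charpoly W M ℓ hℓv hw₂ h𝔔₂ hΦ₂ rfl S₂ hS₂mem
      ⟨_, hresD₂⟩ rfl]
  -- `τ 𝔓₁ = 𝔓₂`
  obtain ⟨τ, hτ⟩ := HeightOneSpectrum.exists_smul_eq_of_mem_primesAbove_holds h𝔓₁ h𝔓₂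
  have hD : ∀ d ∈ DP₁, τ * d * τ⁻¹ ∈ DP₂ := by
    intro d hd
    rw [hDP₂, Ideal.mem_decompositionSubgroup_iff, ← hτ, mul_smul, mul_smul, inv_smul_smul,
      Ideal.mem_decompositionSubgroup_iff.mp hd]
  have hI : ∀ x : absoluteGaloisGroup K, x ∈ 𝔓₁.inertia (absoluteGaloisGroup K) ↔
      τ * x * τ⁻¹ ∈ 𝔓₂.inertia (absoluteGaloisGroup K) := by
    intro x
    have h := inertia_comap_conj_eq 𝔓₂ τ
    rw [← hτ, inv_smul_smul] at h
    rw [hτ] at h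
    rw [← h, Subgroup.mem_comap]
    rfl
  have hSconj : ∀ y : DP₂, y ∈ S₂ ↔ ∃ x : DP₁, x ∈ S₁ ∧ τ * (x : absoluteGaloisGroup K) * τ⁻¹ = y := by
    intro y
    rw [hS₂mem]
    constructor
    · rintro ⟨hyI, hyR⟩
      have hx₀D : τ⁻¹ * y * τ⁻¹⁻¹ ∈ DP₁ := by
        have h2 : (y : absoluteGaloisGroup K) • 𝔓₂ = 𝔓₂ :=
          Ideal.mem_decompositionSubgroup_iff.mp y.2
        have h𝔓₁eq : 𝔓₁ = τ⁻¹ • 𝔓₂ := eq_inv_smul_iff.mpr hτ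
        rw [hDP₁, Ideal.mem_decompositionSubgroup_iff, inv_inv, h𝔓₁eq, mul_smul, mul_smul,
          smul_inv_smul, h2]
      refine ⟨⟨τ⁻¹ * y * τ⁻¹⁻¹, hx₀D⟩, ?_, ?_⟩
      · rw [hS₁mem]
        refine ⟨?_, ?_⟩
        · change τ⁻¹ * (y : absoluteGaloisGroup K) * τ⁻¹⁻¹ ∈ _
          rw [hI]
          rw [show τ * (τ⁻¹ * (y : absoluteGaloisGroup K) * τ⁻¹⁻¹) * τ⁻¹ = y by group]
          exact hyI
        · change τ⁻¹ * (y : absoluteGaloisGroup K) * τ⁻¹⁻¹ ∈ R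
          exact hRN.conj_mem _ hyR _
      · change τ * (τ⁻¹ * (y : absoluteGaloisGroup K) * τ⁻¹⁻¹) * τ⁻¹ = y
        group
    · rintro ⟨x, hx, hxy⟩
      rw [hS₁mem] at hx
      rw [← hxy]
      exact ⟨(hI x).mp hx.1, hRN.conj_mem _ hx.2 _⟩
  rw [charpoly_toCoinvariants_conj ρ.toRepresentation τ DP₁ DP₂ hD S₁ S₂ hSconj ⟨_, hresD₁⟩]
  -- the two Frobenii at `𝔓₂` differ by an element of `S₂`
  congr 2
  apply toCoinvariants_eq_of_mul_inv_mem
  rw [hS₂mem]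
  set q := v.residueCard with hq
  have hq₁ : w₁.residueCard = q ^ w₁.asIdeal.inertiaDeg (𝓞 K) :=
    residueCard_eq_pow_inertiaDeg_of_under_eq hw₁
  have hq₂ : w₂.residueCard = q ^ w₂.asIdeal.inertiaDeg (𝓞 K) :=
    residueCard_eq_pow_inertiaDeg_of_under_eq hw₂
  have hF₁ : ∀ x : absIntegers (𝓞 K) K,
      absGaloisRestrict K M Φ₁ • x - x ^ q ^ w₂.asIdeal.inertiaDeg (𝓞 K) ∈ 𝔓₁ := by
    rw [← hf, ← hq₁, h𝔓₁def, hι]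
    exact (forall_smul_sub_pow_mem_comap_iff K M 𝔔₁ Φ₁ _).mpr
      ((HeightOneSpectrum.isArithFrobAt_iff_of_mem_primesAbove h𝔔₁ Φ₁).mp hΦ₁)
  have hF₂ : ∀ x : absIntegers (𝓞 K) K,
      absGaloisRestrict K M Φ₂ • x - x ^ q ^ w₂.asIdeal.inertiaDeg (𝓞 K) ∈ 𝔓₂ := by
    rw [← hq₂, h𝔓₂def, hι]
    exact (forall_smul_sub_pow_mem_comap_iff K M 𝔔₂ Φ₂ _).mpr
      ((HeightOneSpectrum.isArithFrobAt_iff_of_mem_primesAbove h𝔔₂ Φ₂).mp hΦ₂)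
  have hF₁' : ∀ x : absIntegers (𝓞 K) K,
      (τ * absGaloisRestrict K M Φ₁ * τ⁻¹) • x - x ^ q ^ w₂.asIdeal.inertiaDeg (𝓞 K) ∈ 𝔓₂ := by
    intro x
    have := forall_conj_smul_sub_pow_mem_smul hF₁ τ x
    rwa [hτ] at this
  refine ⟨?_, ?_⟩
  · exact mul_inv_mem_inertia_of_forall_smul_sub_pow_mem hF₁' hF₂
  · change τ * absGaloisRestrict K M Φ₁ * τ⁻¹ * (absGaloisRestrict K M Φ₂)⁻¹ ∈ R
    exact R.mul_mem (hRN.conj_mem _ ⟨Φ₁, rfl⟩ _) (R.inv_mem ⟨Φ₂, rfl⟩)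

end Dictionary

/-! ### The local identity -/

section Main

variable {K : Type u} [Field K] [NumberField K] (W : WeierstrassCurve K) [W.IsElliptic]
  (M : Type u) [Field M] [NumberField M] [Algebra K M] [FiniteDimensional K M]

/-- `reverse` commutes with `map` for monic polynomials. [folklore] -/
theorem reverse_map_of_monic {R S : Type*} [CommRing R] [CommRing S] [Nontrivial S]
    (f : R →+* S) {p : R[X]} (hp : p.Monic) : (p.map f).reverse = p.reverse.map f := by
  rw [Polynomial.reverse, Polynomial.reverse, hp.natDegree_map, Polynomial.reflect_map]

/-- The representation of `D ≤ Γ` underlying a twisted framed representation is the twist of the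
underlying representation (`FramedRep.coe_twist_apply`). [folklore] -/
theorem toRepresentation_twist_comp_subtype {Γ : Type*} [Group Γ] [TopologicalSpace Γ]
    [IsTopologicalGroup Γ] {A : Type*} [Field A] [TopologicalSpace A] [IsTopologicalRing A]
    {n : ℕ} (ρ : FramedRep Γ A n) (χ : Γ →ₜ* Aˣ) (D : Subgroup Γ) :
    (ρ.twist χ).toRepresentation.comp D.subtype =
      Literature.RepresentationTheory.Semisimple.Representation.twist
        (ρ.toRepresentation.comp D.subtype) ((χ : Γ →* Aˣ).comp D.subtype) := by
  refine MonoidHom.ext fun d => LinearMap.ext fun v => ?_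
  change ((ρ.twist χ d : GL (Fin n) A) : Matrix (Fin n) (Fin n) A) *ᵥ v =
    ((χ d : Aˣ) : A) • ((((ρ d : GL (Fin n) A) : Matrix (Fin n) (Fin n) A)) *ᵥ v)
  rw [FramedRep.coe_twist_apply, Matrix.smul_mulVec]

set_option maxHeartbeats 3200000 in
set_option synthInstance.maxHeartbeats 80000 in
/-- **Abelian Artin formalism for `E_M`, one prime of `K̄` at a time (Galois side).**
Let `E/K` be an elliptic curve, `M/K` a finite abelian extension, `ℓ` a prime, `ℚ_ℓ → 𝔼` a
continuous homomorphism into a topological field of characteristic `0`, `V` a framed model of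
`V_ℓ(E)` (`eV`, `heV`) with base change `V_𝔼`, and `(ψᵢ)` a finite family of continuous
characters `Γ_K → 𝔼ˣ` trivial on `Γ_M` satisfying the orthogonality relations of the full
character group of `Gal(M/K) = Γ_K/Γ_M` (`horth₁`, `horth₀`; so `#ψ = [M : K]`).  Then for every
finite place `v ∤ ℓ` of `K`, every prime `𝔓 ∣ v` of `\bar ℤ_K` and arithmetic Frobenius `φ ∈ D_𝔓`:

`∏_{w ∣ v} L_w(E_M, T^{f(w|v)}) = ∏ᵢ det(1 - φ T | (V_𝔼 ⊗ ψᵢ)_{I_𝔓})` in `𝔼[T]`.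

Proof.  Write `D = D_𝔓 ⊇ I = I_𝔓`, `R = Gal(K̄/M) ⊴ Γ_K` (abelian quotient), `D_F = D ∩ R`,
`S = I ∩ R`.  The abstract trace computation
`prod_reverse_charpoly_toCoinvariants_twist_eq_pow_expand` gives
`∏ᵢ det(1 - φT | (V⊗ψᵢ)_I) = det(1 - Φ T^f | V_S)^g` for a Frobenius `Φ ∈ D_F` of `M`
(`res Φ_M ≡ φ^f mod I`, `f = f(w|v)` minimal: residue fields), provided `g f [I : S] = #ψ`; here
`#ψ = [M:K] = [Γ_K : R]` (`index_range_absGaloisRestrict_eq_finrank`),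
`[Γ_K : R] = #{w ∣ v} · [D : D_F]` (double cosets `D \ Γ_K / R` = places above `v`,
`index_eq_card_mul_index_subgroupOf`) and `[D : D_F] = f [I : S]` (`D = ⟨φ⟩ I R`,
`exists_eq_frobenius_pow_mul_of_mem_decompositionSubgroup`;
`index_eq_mul_index_subgroupOf_of_generator`), so `g = #{w ∣ v}`.  Finally
`det(1 - ΦT | V_S) = L_{w₀}(E_M, T)` for the place `w₀` below `𝔓`
(`map_localPolynomialAt_baseChange_eq_reverse_charpoly`, base change `ℚ_ℓ → 𝔼`:
`charpoly_toCoinvariants_map`), and all `L_w(E_M,T)`, `w ∣ v`, agree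
(`localPolynomialAt_baseChange_eq_of_isGalois`).  This is the local form of
`L(E_M, s) = ∏_χ L(E ⊗ χ, s)` (Artin formalism for the abelian extension `M/K`) valid at every
prime, including the additive ones.
[cite: NeukirchANT1999, VII (10.4) (iv), proof pp. 523–524] [cite: IrelandRosen1990, Ch. 20 §5,
Prop. 20.5.4(b) (PDF p. 353)] -/
theorem map_prod_expand_localPolynomialAt_baseChange_eq_prod_twist [IsAbelianGalois K M]
    (ℓ : ℕ) [Fact ℓ.Prime] {𝔼 : Type*} [Field 𝔼] [CharZero 𝔼] [TopologicalSpace 𝔼]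
    [IsTopologicalRing 𝔼] (iE : ℚ_[ℓ] →+* 𝔼) (hiE : Continuous iE)
    (VQ : FramedGaloisRep K ℚ_[ℓ] 2)
    (eV : (Fin 2 → ℚ_[ℓ]) ≃ₗ[ℚ_[ℓ]] W.rationalTateModule ℓ)
    (heV : ∀ (σ : absoluteGaloisGroup K) (x : Fin 2 → ℚ_[ℓ]),
      eV (FramedRep.toRepresentation VQ σ x) = W.rationalGaloisRepTate ℓ σ (eV x))
    {ιΨ : Type*} [Fintype ιΨ] (ψ : ιΨ → (absoluteGaloisGroup K →ₜ* 𝔼ˣ))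
    (hψ : ∀ i (γ : absoluteGaloisGroup M), ψ i (absGaloisRestrict K M γ) = 1)
    (horth₁ : ∀ σ ∈ (absGaloisRestrict K M).range, ∑ i, ((ψ i σ : 𝔼ˣ) : 𝔼) = Fintype.card ιΨ)
    (horth₀ : ∀ σ ∉ (absGaloisRestrict K M).range, ∑ i, ((ψ i σ : 𝔼ˣ) : 𝔼) = 0)
    (hcard : Fintype.card ιΨ = Module.finrank K M)
    {v : HeightOneSpectrum (𝓞 K)} (hℓv : (ℓ : 𝓞 K) ∉ v.asIdeal)
    {𝔓 : Ideal (absIntegers (𝓞 K) K)} (h𝔓 : 𝔓 ∈ v.primesAbove)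
    (φ : 𝔓.decompositionSubgroup (absoluteGaloisGroup K))
    (hφ : IsArithFrobAt (𝓞 K) (φ : absoluteGaloisGroup K) 𝔓)
    [Fintype {w : HeightOneSpectrum (𝓞 M) // w.under (𝓞 K) = v}] :
    (∏ w : {w : HeightOneSpectrum (𝓞 M) // w.under (𝓞 K) = v},
        expand ℤ (w.1.asIdeal.inertiaDeg (𝓞 K)) ((W.baseChange M).localPolynomialAt w.1)).map
        (Int.castRingHom 𝔼) =
      ∏ i, (ContinuousRep.toInertiaCoinvariants
        (FramedGaloisRep.toGaloisRep ((VQ.baseChange iE hiE).twist (ψ i))) 𝔓 φ).charpoly.reverse := by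
  classical
  haveI : Algebra.IsAlgebraic K M := Algebra.IsAlgebraic.of_finite K M
  haveI := W.module_finite_rationalTateModule_holds ℓ
  have hcW := W.continuous_rationalGaloisRepTate_holds ℓ
  set ρ := rationalTateGaloisRepOf (WeierstrassCurve.geomPoints W) ℓ hcW with hρ
  /- ### `R = Gal(K̄/M)` -/
  set res : absoluteGaloisGroup M →* absoluteGaloisGroup K := (absGaloisRestrict K M).toMonoidHom
    with hres
  have hresa : ∀ γ, res γ = absGaloisRestrict K M γ := fun _ => rfl
  set R : Subgroup (absoluteGaloisGroup K) := (absGaloisRestrict K M).range with hR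
  haveI hRN : R.Normal := normal_range_absGaloisRestrict K M
  have hRopen : IsOpen (R : Set (absoluteGaloisGroup K)) := isOpen_range_absGaloisRestrict K M
  have hRidx : R.index = Module.finrank K M := index_range_absGaloisRestrict_eq_finrank K M
  /- ### the prime `𝔔` of `\bar ℤ_M` below `𝔓`, its place `w₀`, a Frobenius `Φ_M` -/
  haveI h𝔓p : 𝔓.IsPrime := h𝔓.1
  set ι := absIntegersMap K M with hι
  set 𝔔 : Ideal (absIntegers (𝓞 M) M) :=
    𝔓.comap ((absIntegersEquiv K M).symm : absIntegers (𝓞 M) M →+* absIntegers (𝓞 K) K) with h𝔔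
  have h𝔔c : 𝔔.comap ι = 𝔓 := by
    rw [h𝔔, hι, ← coe_absIntegersEquiv]
    exact Ideal.comap_of_equiv _
  haveI : 𝔔.IsPrime := Ideal.comap_isPrime _ _
  have h𝔔v : 𝔔.comap (absIntegersMap K M) ∈ v.primesAbove := by rw [← hι, h𝔔c]; exact h𝔓
  obtain ⟨w₀, hw₀, h𝔔w₀, -⟩ := exists_heightOneSpectrum_of_comap_absIntegersMap_mem_primesAbove h𝔔v
  obtain ⟨ΦM, hΦM⟩ := HeightOneSpectrum.exists_isArithFrobAt_of_mem_primesAbove_holds h𝔔w₀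
  have hunder : 𝔔.under (𝓞 M) = w₀.asIdeal := h𝔔w₀.2.over.symm
  set f := w₀.asIdeal.inertiaDeg (𝓞 K) with hfdef
  have hfpos : 0 < f := by
    rw [hfdef]
    haveI : w₀.asIdeal.IsMaximal := w₀.isMaximal
    haveI : w₀.asIdeal.LiesOver v.asIdeal := ⟨hw₀.symm⟩
    exact Ideal.inertiaDeg_pos w₀.asIdeal (𝓞 K)
  /- ### the groups `D ⊇ I, D_F`, the element `Φ` -/
  have hφD : (φ : absoluteGaloisGroup K) ∈ 𝔓.decompositionSubgroup (absoluteGaloisGroup K) := φ.2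
  set ID : Subgroup (𝔓.decompositionSubgroup (absoluteGaloisGroup K)) := 𝔓.inertia _ with hID
  haveI : ID.Normal := inferInstanceAs (𝔓.inertia _).Normal
  set DF : Subgroup (𝔓.decompositionSubgroup (absoluteGaloisGroup K)) := R.subgroupOf _ with hDF
  haveI : DF.Normal := Subgroup.normal_subgroupOf
  have hmemID : ∀ x, x ∈ ID ↔ (x : absoluteGaloisGroup K) ∈ 𝔓.inertia (absoluteGaloisGroup K) :=
    fun x ↦ Iff.rfl
  have hmemDF : ∀ x, x ∈ DF ↔ (x : absoluteGaloisGroup K) ∈ R := fun x ↦ Iff.rfl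
  have hidx0 : R.index ≠ 0 := by rw [hRidx]; exact Module.finrank_pos.ne'
  haveI : DF.FiniteIndex := by
    refine ⟨fun h0 => hidx0 ?_⟩
    have hd := Subgroup.relIndex_dvd_index_of_normal R
      (𝔓.decompositionSubgroup (absoluteGaloisGroup K))
    rw [Subgroup.relIndex, ← hDF, h0, zero_dvd_iff] at hd
    exact hd
  have hresD : absGaloisRestrict K M ΦM ∈ 𝔓.decompositionSubgroup (absoluteGaloisGroup K) := by
    have h : ΦM ∈ (𝔓.decompositionSubgroup (absoluteGaloisGroup K)).comap res := by
      rw [← h𝔔c, hres, hι, comap_decompositionSubgroup_comap_absIntegersMap K M 𝔔]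
      exact hΦM.mem_stabilizer
    exact h
  set Φ' : 𝔓.decompositionSubgroup (absoluteGaloisGroup K) := ⟨_, hresD⟩ with hΦ'
  have hΦF : Φ' ∈ DF := (hmemDF _).2 ⟨ΦM, rfl⟩
  have hφ𝔔 : IsArithFrobAt (𝓞 K) (φ : absoluteGaloisGroup K) (𝔔.comap (absIntegersMap K M)) := by
    rw [← hι, h𝔔c]; exact hφ
  have hΦI : Φ' * (φ ^ f)⁻¹ ∈ ID := by
    rw [hmemID]
    have h := absGaloisRestrict_mul_pow_inv_mem_inertia hw₀ h𝔔w₀ hΦM hφ𝔔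
    rw [← hι, h𝔔c] at h
    exact h
  /- ### minimality of `f` -/
  set q := v.residueCard with hq
  have hmin : ∀ m : ℕ, 0 < m → (∃ i ∈ ID, φ ^ m * i ∈ DF) → f ∣ m := by
    rintro m - ⟨i, hi, hφi⟩
    rw [hmemDF] at hφi
    obtain ⟨γ, hγ⟩ := hφi
    have hfrm : ∀ x : absIntegers (𝓞 K) K,
        ((φ : absoluteGaloisGroup K) ^ m * (i : absoluteGaloisGroup K)) • x - x ^ q ^ m ∈ 𝔓 :=
      forall_mul_smul_sub_pow_mem_of_mem_inertia (pow_smul_sub_pow_mem_of_isArithFrobAt h𝔓 hφ m)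
        ((hmemID i).1 hi) (Ideal.mem_decompositionSubgroup_iff.mp
          ((𝔓.decompositionSubgroup (absoluteGaloisGroup K)).pow_mem φ.2 m))
    have hgM : ∀ z : absIntegers (𝓞 M) M, γ • z - z ^ q ^ m ∈ 𝔔 := by
      rw [← forall_smul_sub_pow_mem_comap_iff K M 𝔔 γ, ← hι, h𝔔c, ← hresa, hγ]
      exact fun x => hfrm x
    refine inertiaDeg_dvd_of_forall_pow_residueCard_pow_eq hw₀ fun x => ?_
    obtain ⟨r, rfl⟩ := Ideal.Quotient.mk_surjective x
    rw [← map_pow, Ideal.Quotient.eq, ← hunder, Ideal.under, Ideal.mem_comap, map_sub, map_pow]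
    have := hgM (algebraMap (𝓞 M) (absIntegers (𝓞 M) M) r)
    rw [smul_algebraMap] at this
    rw [← neg_mem_iff, neg_sub]
    exact this
  /- ### `D = ⟨φ⟩ I D_F` -/
  have hgen : ∀ d : 𝔓.decompositionSubgroup (absoluteGaloisGroup K),
      ∃ (a : ℕ) (i : 𝔓.decompositionSubgroup (absoluteGaloisGroup K)),
        i ∈ ID ∧ (φ ^ a * i)⁻¹ * d ∈ DF := by
    intro d
    obtain ⟨n, i, u, hi, hu, hd⟩ :=
      exists_eq_frobenius_pow_mul_of_mem_decompositionSubgroup h𝔓 hφ hRopen d.2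
    refine ⟨n, ⟨i, Ideal.inertia_le_decompositionSubgroup _ _ hi⟩, (hmemID _).2 hi, ?_⟩
    rw [hmemDF]
    change (((φ : absoluteGaloisGroup K) ^ n * i)⁻¹ * d : absoluteGaloisGroup K) ∈ R
    rw [hd, show ((φ : absoluteGaloisGroup K) ^ n * i)⁻¹ * ((φ : absoluteGaloisGroup K) ^ n * i * u)
      = u by group]
    exact hu
  have hpow : ∃ i ∈ ID, ∃ u ∈ DF, φ ^ f = i * u :=
    ⟨(Φ' * (φ ^ f)⁻¹)⁻¹, ID.inv_mem hΦI, Φ', hΦF, by group⟩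
  /- ### the count `g f [I : S] = #ψ` -/
  -- per place `w ∣ v`: a prime `𝔔_w ∣ w` and `τ_w` with `τ_w (ι⁻¹ 𝔔_w) = 𝔓`
  have hwv : ∀ w : {w : HeightOneSpectrum (𝓞 M) // w.under (𝓞 K) = v},
      w.1.asIdeal.under (𝓞 K) = v.asIdeal := fun w => congrArg HeightOneSpectrum.asIdeal w.2
  have hdata : ∀ w : {w : HeightOneSpectrum (𝓞 M) // w.under (𝓞 K) = v},
      ∃ 𝔔' : Ideal (absIntegers (𝓞 M) M), ∃ τ : absoluteGaloisGroup K,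
        𝔔' ∈ w.1.primesAbove ∧ τ • 𝔔'.comap ι = 𝔓 := by
    intro w
    obtain ⟨𝔔', h𝔔'⟩ := w.1.primesAbove_nonempty
    obtain ⟨τ, hτ⟩ := HeightOneSpectrum.exists_smul_eq_of_mem_primesAbove_holds
      (comap_absIntegersMap_mem_primesAbove (hwv w) h𝔔') h𝔓
    exact ⟨𝔔', τ, h𝔔', hτ⟩
  choose 𝔔w τ h𝔔w hτ using hdata
  have h𝔔wp : ∀ w, (𝔔w w).IsPrime := fun w => (h𝔔w w).1
  have hcomap : ∀ w, (𝔔w w).comap ι = (τ w)⁻¹ • 𝔓 := fun w => by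
    rw [← hτ w, inv_smul_smul]
  have hunderw : ∀ w, (𝔔w w).under (𝓞 M) = w.1.asIdeal := fun w => (h𝔔w w).2.over.symm
  -- double cosets: covering
  have h1 : ∀ x : absoluteGaloisGroup K, ∃ w, ∃ d ∈ 𝔓.decompositionSubgroup (absoluteGaloisGroup K),
      ∃ r ∈ R, x = d * τ w * r := by
    intro x
    have h𝔓x : x⁻¹ • 𝔓 ∈ v.primesAbove := smul_mem_primesAbove h𝔓 x⁻¹
    set 𝔔x : Ideal (absIntegers (𝓞 M) M) :=
      (x⁻¹ • 𝔓).comap ((absIntegersEquiv K M).symm : absIntegers (𝓞 M) M →+* absIntegers (𝓞 K) K)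
      with h𝔔x
    have h𝔔xc : 𝔔x.comap ι = x⁻¹ • 𝔓 := by
      rw [h𝔔x, hι, ← coe_absIntegersEquiv]
      exact Ideal.comap_of_equiv _
    haveI : 𝔔x.IsPrime := by
      haveI := h𝔓x.1
      exact Ideal.comap_isPrime _ _
    have h𝔔xv : 𝔔x.comap (absIntegersMap K M) ∈ v.primesAbove := by rw [← hι, h𝔔xc]; exact h𝔓x
    obtain ⟨w₁, hw₁, h𝔔xw, -⟩ :=
      exists_heightOneSpectrum_of_comap_absIntegersMap_mem_primesAbove h𝔔xv
    let w : {w : HeightOneSpectrum (𝓞 M) // w.under (𝓞 K) = v} := ⟨w₁, HeightOneSpectrum.ext hw₁⟩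
    obtain ⟨γ, hγ⟩ := HeightOneSpectrum.exists_smul_eq_of_mem_primesAbove_holds h𝔔xw (h𝔔w w)
    have key : (res γ * x⁻¹) • 𝔓 = (τ w)⁻¹ • 𝔓 := by
      rw [mul_smul, ← h𝔔xc, hresa, ← comap_absIntegersMap_smul, hγ, ← hι, hcomap w]
    have hd : τ w * res γ * x⁻¹ ∈ 𝔓.decompositionSubgroup (absoluteGaloisGroup K) := by
      rw [Ideal.mem_decompositionSubgroup_iff, mul_assoc, mul_smul, key, smul_inv_smul]
    refine ⟨w, (τ w * res γ * x⁻¹)⁻¹, Subgroup.inv_mem _ hd, res γ, ⟨γ, rfl⟩, by group⟩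
  -- double cosets: disjointness
  have h2 : ∀ i j, (∃ d ∈ 𝔓.decompositionSubgroup (absoluteGaloisGroup K), ∃ r ∈ R,
      τ j = d * τ i * r) → i = j := by
    rintro i j ⟨d, hd, r, ⟨g, rfl⟩, hEq⟩
    have hd' : d⁻¹ • 𝔓 = 𝔓 := by
      rw [inv_smul_eq_iff]
      exact (Ideal.mem_decompositionSubgroup_iff.mp hd).symm
    have hij : (𝔔w j).comap ι = (g⁻¹ • 𝔔w i).comap ι := by
      rw [hι, comap_absIntegersMap_smul, ← hι, hcomap i, hcomap j, hEq, mul_inv_rev, mul_inv_rev,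
        mul_smul, mul_smul, hd', map_inv]
      rfl
    have hQ : 𝔔w j = g⁻¹ • 𝔔w i :=
      Ideal.comap_injective_of_surjective _ (absIntegersMap_surjective K M) hij
    apply Subtype.ext
    apply HeightOneSpectrum.ext
    rw [← hunderw i, ← hunderw j, hQ, under_smul_absIntegers]
  have hcount₁ := index_eq_card_mul_index_subgroupOf R
    (𝔓.decompositionSubgroup (absoluteGaloisGroup K)) τ h1 h2
  have hcount₂ := index_eq_mul_index_subgroupOf_of_generator ID DF hfpos hgen hpow hmin
  have hg : Fintype.card {w : HeightOneSpectrum (𝓞 M) // w.under (𝓞 K) = v} * f *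
      (DF.subgroupOf ID).index = Fintype.card ιΨ := by
    rw [hcard, ← hRidx, hcount₁, Nat.card_eq_fintype_card, mul_assoc, ← hcount₂]
  /- ### the representation and the characters on `D` -/
  set VE := VQ.baseChange iE hiE with hVE
  set ρDE : Representation 𝔼 (𝔓.decompositionSubgroup (absoluteGaloisGroup K)) (Fin 2 → 𝔼) :=
    (FramedRep.toRepresentation VE).comp (𝔓.decompositionSubgroup (absoluteGaloisGroup K)).subtype
    with hρDE
  set ψD : ιΨ → (𝔓.decompositionSubgroup (absoluteGaloisGroup K) →* 𝔼ˣ) :=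
    fun i => (ψ i : absoluteGaloisGroup K →* 𝔼ˣ).comp
      (𝔓.decompositionSubgroup (absoluteGaloisGroup K)).subtype with hψD
  have hψDa : ∀ i x, ψD i x = ψ i (x : absoluteGaloisGroup K) := fun _ _ => rfl
  have hψD : ∀ i, ID ⊓ DF ≤ (ψD i).ker := by
    intro i x hx
    rw [MonoidHom.mem_ker, hψDa]
    obtain ⟨γ, hγ⟩ := (hmemDF x).1 hx.2
    rw [← hγ]
    exact hψ i γ
  have horth₁' : ∀ x ∈ DF, ∑ i, ((ψD i x : 𝔼ˣ) : 𝔼) = (Fintype.card ιΨ : ℕ) := fun x hx => by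
    simp only [hψDa]
    exact horth₁ _ ((hmemDF x).1 hx)
  have horth₀' : ∀ x ∉ DF, ∑ i, ((ψD i x : 𝔼ˣ) : 𝔼) = 0 := fun x hx => by
    simp only [hψDa]
    exact horth₀ _ (fun h => hx ((hmemDF x).2 h))
  /- ### the abstract identity -/
  have main := prod_reverse_charpoly_toCoinvariants_twist_eq_pow_expand ρDE ID DF ψD hψD
    (Fintype.card ιΨ) horth₁' horth₀' hfpos hΦF hΦI hmin hg
  /- ### left-hand side: the twists -/
  have hfac : ∀ i, (ContinuousRep.toInertiaCoinvariants
      (FramedGaloisRep.toGaloisRep (VE.twist (ψ i))) 𝔓 φ).charpoly.reverse =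
      ((Literature.RepresentationTheory.Semisimple.Representation.twist ρDE
        (ψD i)).toCoinvariants ID φ).charpoly.reverse := by
    intro i
    have h := toRepresentation_twist_comp_subtype VE (ψ i)
      (𝔓.decompositionSubgroup (absoluteGaloisGroup K))
    change (Representation.toCoinvariants ((FramedRep.toRepresentation (VE.twist (ψ i))).comp
      (𝔓.decompositionSubgroup (absoluteGaloisGroup K)).subtype) ID φ).charpoly.reverse = _
    rw [h]
  rw [Finset.prod_congr rfl fun i _ => hfac i, main]
  /- ### right-hand side: `det(1 - Φ T | V_S) = L_{w₀}(E_M, T)` -/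
  set S := ID ⊓ DF with hSdef
  have hSmem : ∀ x, x ∈ S ↔ (x : absoluteGaloisGroup K) ∈ 𝔓.inertia (absoluteGaloisGroup K) ∧
      (x : absoluteGaloisGroup K) ∈ (absGaloisRestrict K M).range := fun x ↦ by
    rw [hSdef, Subgroup.mem_inf, hmemID, hmemDF]
  -- base change `ℚ_ℓ → 𝔼`
  set ρDQ : Representation ℚ_[ℓ] (𝔓.decompositionSubgroup (absoluteGaloisGroup K)) (Fin 2 → ℚ_[ℓ]) :=
    (FramedRep.toRepresentation VQ).comp (𝔓.decompositionSubgroup (absoluteGaloisGroup K)).subtype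
    with hρDQ
  have hbc : (ρDE.toCoinvariants S Φ').charpoly = ((ρDQ.toCoinvariants S Φ').charpoly).map iE :=
    charpoly_toCoinvariants_map iE
      ((VQ : absoluteGaloisGroup K →* GL (Fin 2) ℚ_[ℓ]).comp
        (𝔓.decompositionSubgroup (absoluteGaloisGroup K)).subtype) S Φ'
  -- the framing `V ≅ V_ℓ(E)`
  set ρDT : Representation ℚ_[ℓ] (𝔓.decompositionSubgroup (absoluteGaloisGroup K))
      (W.rationalTateModule ℓ) :=
    ρ.toRepresentation.comp (𝔓.decompositionSubgroup (absoluteGaloisGroup K)).subtype with hρDT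
  have hfr : (ρDQ.toCoinvariants S Φ').charpoly = (ρDT.toCoinvariants S Φ').charpoly := by
    have hE : ∀ (g : 𝔓.decompositionSubgroup (absoluteGaloisGroup K)) (x : Fin 2 → ℚ_[ℓ]),
        eV (ρDQ g x) = ρDT (MonoidHom.id _ g) (eV x) := fun g x => heV g x
    have hmap := map_ker_comp_subtype_eq_of_equiv ρDT ρDQ (MonoidHom.id _) eV hE S
    rw [Subgroup.map_id] at hmap
    exact charpoly_toCoinvariants_eq_of_map_ker_eq ρDT ρDQ (MonoidHom.id _) eV hE S S hmap Φ'
  -- the dictionary at `w₀`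
  have hdict := map_localPolynomialAt_baseChange_eq_reverse_charpoly W M ℓ hℓv hw₀ h𝔔w₀ hΦM
    h𝔔c S hSmem Φ' rfl
  have hRHS : (ρDE.toCoinvariants S Φ').charpoly.reverse =
      ((W.baseChange M).localPolynomialAt w₀).map (Int.castRingHom 𝔼) := by
    rw [hbc, reverse_map_of_monic iE (LinearMap.charpoly_monic _), hfr, ← hdict,
      Polynomial.map_map]
    congr 1
    ext n
    simp
  rw [hRHS, ← Polynomial.map_expand]
  /- ### all `L_w(E_M, T)`, `w ∣ v`, agree -/
  haveI : IsGaloisGroup (M ≃ₐ[K] M) (𝓞 K) (𝓞 M) := IsGaloisGroup.of_isFractionRing _ _ _ K M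
  have hLw : ∀ w : {w : HeightOneSpectrum (𝓞 M) // w.under (𝓞 K) = v},
      expand ℤ (w.1.asIdeal.inertiaDeg (𝓞 K)) ((W.baseChange M).localPolynomialAt w.1) =
        expand ℤ f ((W.baseChange M).localPolynomialAt w₀) := by
    intro w
    haveI := w.1.isPrime
    haveI := w₀.isPrime
    haveI : w.1.asIdeal.LiesOver v.asIdeal := ⟨(hwv w).symm⟩
    haveI : w₀.asIdeal.LiesOver v.asIdeal := ⟨hw₀.symm⟩
    rw [localPolynomialAt_baseChange_eq_of_isGalois W M (hwv w) hw₀, hfdef,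
      Ideal.inertiaDeg_eq_of_isGaloisGroup v.asIdeal w.1.asIdeal w₀.asIdeal (M ≃ₐ[K] M)]
  rw [Finset.prod_congr rfl fun w _ => hLw w, Finset.prod_const, Finset.card_univ,
    Polynomial.map_pow]

end Main

end Literature.NumberTheory.EllipticCurves

end
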